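import Summits.QuantumFields.YangMills.Theorems.BalabanUVNodesN07MinTokensOfCriticalRowAtRecord
import HarnessLib

/-!
# N07 at the record — [15] SECT. D (100), (105)–(110) AS LINEAR ALGEBRA OF THE RECORD's LETTERS: on the tangent space (83) `{Qδ = 0, RD*δ = 0}` the energy form
# of the Euler–Lagrange map, `⟨δ, Δ_{1,a}(U₀)(A − T(A))⟩` (`T` = Prop. 6's map (116), `𝔊 = G₁𝔓*`, `𝔄 = H₁B`), EQUALS print's (84)∕(99) pairing
# `⟨δ, J⟩ + ⟨δ, Δ₁(A + 𝔄)⟩ + ⟨δ, W(A + 𝔄)⟩` — HYPOTHESIS-FREE at the record (any Hessian slot `Δ₁`, any `W`, `J`)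

Cell `pub-ymgap`, seat `pub-ymgap-dag-n07-w3` (g29, WIDTH SEAT 3 on N07 [B11] = [15]); helper file keyed `--kind proof --supports stmt-QuantumFields-27238 --as helper` (K0ᴬ road);
count-neutral.  INTENT-3 of the seat.

## Why

✓`N07MinTokensOfCriticalRowAtRecord.minTokens_ofRecord_landau` (INTENT-2) reduced the door's knit tokens (min) ∧ (c→s) at the scheme of record to ONE displayed row, (84)+(110):
the line derivative of `A^η ∘ S.chartLin T V` in a tangent direction `δ` is `c·ℜ⟪ιδ, Δ_{1,a}(U₀) ι(A − T A)⟫`.  This file splits that row into its two printed halves and PROVES the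
second: the Sect. D algebra (100) «`⟨δA′, Δ₁H₁B⟩ = 0`», (105)–(110) «`Δ₁ = Δ_{1,a} − DRD* − aQ*Q` on (83)», «`Δ_{1,a}𝔊 = 𝔓*`, `⟨δ, 𝔓*f⟩ = ⟨δ, f⟩` on (83)» holds for the
record's CONSTRUCTED letters (lit ✓`laplaceALatticeK_G1LatticeK`, ✓`adjoint_covDerivL2K` with ✓`conj_cRec` ∕ ✓`inner_RRec_left`, ✓`RrOfRecord_isSymmetric`, Hilbert adjoint of `Q`) with
NO displayed hypothesis — so after this file the residual displayed row of the (min) ∧ (c→s) knit is print's (84) VERBATIM: «the derivative of `𝔉` along the chart, paired with a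
tangent direction, is `⟨δ, J⟩ + ⟨δ, Δ₁A′⟩ + ⟨δ, W(A′)⟩`» ((81) differentiated) — the N07 expansion programme's natural deliverable.

## What is here (slot-generic: any Hessian datum `Δ₁`, the record's `Q(U₀) = QOfRecord`, `Q′♭ = QflatOfRecord`; `ι` = any linear reading of jets as `L²` bond functions that
AGREES with the canonical one, hypothesis `hι`; `f ↦ f̂` = the same reading of a current)

* §1 `iota_frakGOfRecordAt` — `ι(𝔊f) = 𝔊_H f̂` (the (115)-typed `𝔊` of record read back on the Hilbert space is lit's ✓`frakGLatticeK`); `laplaceA_frakGLatticeK` — `Δ_{1,a}(𝔊_H x) = 𝔓*x`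
  unfolded; ★ `inner_laplaceA_frakG_of_tangent` — `⟪x, Δ_{1,a}(𝔊_H y)⟫ = ⟪x, y⟫` for `Qx = 0`, `RD*x = 0`; ★ `inner_laplaceA_eq_inner_hess_of_tangent` — `⟪x, Δ_{1,a} y⟫ = ⟪x, Δ₁ y⟫` on (83);
  `iota_H1OfRecordAt` — `ι(H₁B) = H₁,H B̂`; ★ `inner_laplaceA_H1_of_tangent` ∕ `inner_hess_H1_of_tangent` — (100) `⟪x, Δ_{1,a}(H₁B̂)⟫ = 0 = ⟪x, Δ₁(H₁B̂)⟫` on `Qx = 0` (∕ (83)).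
* §2 ★★★ `inner_laplaceA_sub_mapT_eq` — THE (110) IDENTITY: for `δ ∈ constraint102OfRecord` (def-Y's (102)∕(109)), any `A`, `V`, `W`, `J`:
  `⟪ιδ, Δ_{1,a} ι(A − mapT 𝔊 0 W J (H₁B(V)) A)⟫ = ⟪ιδ, Ĵ⟫ + ⟪ιδ, Δ₁ ι(A + H₁B(V))⟫ + ⟪ιδ, (W(A + H₁B(V)))^⟫`; ★★★ `inner_laplaceA_sub_mapT_eq_bg128` — the same at the scheme's
  slot-(c) letters `frakGOfRecordAtBg128` ∕ `frakAOfRecordAtBg128` ∕ `hessOpOfRecord128`.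
* §4 ★★★ `minTokens_ofRecord_landau_of_row84` — ✓`minTokens_ofRecord_landau` RE-KEYED: the knit tokens (min) ∧ (c→s) at the scheme of record for the Landau family modulo
  print's (84) VERBATIM as the one displayed row: `HasDerivAt (t ↦ A^η(S.chartLin T V (A + t•δ))) (c·ℜ(⟪ιδ, Ĵ⟫ + ⟪ιδ, Δ₁ ι(A + 𝔄V)⟫ + ⟪ιδ, (W(A + 𝔄V))^⟫)) 0`.

## Honest labels

Finite-dimensional linear algebra on CONSTRUCTED letters; nothing displayed, nothing of Bałaban's estimates; the remaining displayed row of the knit — (84) itself — is NOT touched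
here.  K0ᴬ ⟨27238⟩ NOT closed; N07 NOT discharged; COUNT∕K UNMOVED; R4 is the conditional finite-𝕋⁴ rung `BalabanLadder.UV` only; finite torus at fixed `ε` — nothing continuum ∕ OS ∕
Clay.  **The Yang–Mills mass gap is NOT proved by any of this.**  No `sorry`, no `def`, no `instance ∕ notation ∕ set_option`; standard axioms.
[cite: Balaban1985Variational, (82)–(84) p.290, (99)–(104) p.293, (105)–(111) p.294; Balaban1985BackgroundPropagators, (3.8) p.392, (3.21) p.394, (3.147) p.425, (3.153) p.426]
-/

noncomputable section

open scoped Matrix Matrix.Norms.L2Operator InnerProductSpace ComplexConjugate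

namespace Summit.QuantumFields.YangMills.Theorems.N07Row110AtRecord

open Literature.MathematicalPhysics.QuantumFieldTheory.Balaban1983to89
open Literature.MathematicalPhysics.QuantumFieldTheory.Balaban1983to89.T4Continuum (T4Family)
open Literature.MathematicalPhysics.QuantumFieldTheory.Balaban1983to89.Node00
open B9Eq311L2Pairing (WL2)
open B11Eq103H1Complex
open B11Eq111FrakG (nabla115 frakG_apply frakGLin_apply)
open B11Eq115Space (NegSize NegSup JetSup)
open B11Prop6Scheme (mapT mapT_noLinear)

section Slot

variable (F : T4Family) (N : ℕ) [NeZero N] {K : ℕ} (k : ℕ) (Ω : ℕ → Set (Site (F.P K) 0)) (U₀ : GaugeField (F.P K) 0 (SU N))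
  [Fact (0 < (F.L : ℝ))] [Fact (0 < (F.P K).eta k)] [Fact (0 < c0Rec F K k)] [Fact (∀ c, 0 < wBRec F K k c)]
  (levB : PBond (F.P K) k → ℕ)
  (Δ₁ : BondL2K ℂ (F.P K).d (fun _ => (F.P K).sitesPerDir 0) (c0Rec F K k) (WRec N) →ₗ[ℂ]
    BondL2K ℂ (F.P K).d (fun _ => (F.P K).sitesPerDir 0) (c0Rec F K k) (WRec N)) (a : ℝ)
  (hpos : ∀ x, x ≠ 0 → 0 < RCLike.re ⟪x, laplaceAOfRecordAt F N k U₀ Δ₁ (QOfRecord F N k U₀) (QflatOfRecord F N k) a x⟫_ℂ)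
  (hQ : Function.Surjective (QOfRecord F N k U₀))
  (ι : Space115Lit F N K k Ω U₀ ≃ₗ[ℂ] BondL2K ℂ (F.P K).d (fun _ => (F.P K).sitesPerDir 0) (c0Rec F K k) (WRec N))
  (hι : ∀ y, ι y = (funEquiv (phiRec N) (fun _ : B9SectCLatticeCarrier.Bond (F.P K).d (fun _ => (F.P K).sitesPerDir 0) => c0Rec F K k)).symm
    (JetSup.equiv _ _ (nabla115 ((F.P K).eta k) (unitsOfRecord F N U₀)) y))

/-! ## §1  The record's `𝔊`, `H₁` read back on the Hilbert space; (105)–(110) and (100) on the tangent space -/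

omit [NeZero N] in
include hι in
/-- **`ι(𝔊f) = 𝔊_H f̂`**: the (115)-typed propagator of record, read back on the `L²` bond space along the canonical reading, IS lit's Hilbert-level ✓`frakGLatticeK`
applied to the current read the same way. [cite: Balaban1985Variational, (111) p.294, (116)–(117) p.295; Balaban1985BackgroundPropagators, (3.153) p.426] -/
theorem iota_frakGOfRecordAt (f : NegSizeLit F N K k Ω 3) :
    ι (frakGOfRecordAt F N K k Ω U₀ Δ₁ (QOfRecord F N k U₀) (QflatOfRecord F N k) a hpos hQ f) =
      frakGLatticeK hpos hQ ((funEquiv (phiRec N) (fun _ : B9SectCLatticeCarrier.Bond (F.P K).d (fun _ => (F.P K).sitesPerDir 0) => c0Rec F K k)).symm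
        (NegSup.equiv _ _ f)) := by
  rw [hι]
  apply (funEquiv (phiRec N) (fun _ : B9SectCLatticeCarrier.Bond (F.P K).d (fun _ => (F.P K).sitesPerDir 0) => c0Rec F K k)).injective
  rw [LinearEquiv.apply_symm_apply]
  simp only [frakGOfRecordAt, frakGLatticeCLM, frakG_apply, frakGLatticeK, frakGLin_apply, G1Fun, QFun, QadjFun, DFun, DstarFun,
    LinearMap.comp_apply, LinearEquiv.coe_coe, readFun_apply, LinearEquiv.symm_apply_apply, map_sub]


omit [NeZero N] [Fact (0 < (F.L : ℝ))] [Fact (0 < (F.P K).eta k)] in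
/-- **`Δ_{1,a}(𝔊_H x) = 𝔓*x` UNFOLDED**: `= x − Q†((QG₁Q*)⁻¹(Q(G₁x))) − D(R(D*(G₁x)))` (✓`laplaceALatticeK_G1LatticeK` thrice on lit's ✓`frakGLin_apply`).
[cite: Balaban1985Variational, (110)–(111) p.294; Balaban1985BackgroundPropagators, (3.153) p.426] -/
theorem laplaceA_frakGLatticeK (x : BondL2K ℂ (F.P K).d (fun _ => (F.P K).sitesPerDir 0) (c0Rec F K k) (WRec N)) :
    laplaceAOfRecordAt F N k U₀ Δ₁ (QOfRecord F N k U₀) (QflatOfRecord F N k) a (frakGLatticeK hpos hQ x) =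
      x - LinearMap.adjoint (QOfRecord F N k U₀) (KinvLatticeK hpos hQ (QOfRecord F N k U₀ (G1LatticeK hpos x))) -
        covDerivL2K ℂ (c0Rec F K k) (cRec F K k) (RRec F N U₀)
          (RrOfRecord F N k U₀ (QflatOfRecord F N k) (covDivL2K ℂ (c0Rec F K k) (cRec F K k) (SRec F N U₀) (G1LatticeK hpos x))) := by
  rw [frakGLatticeK, frakGLin_apply, map_sub, map_sub]
  erw [laplaceALatticeK_G1LatticeK hpos, laplaceALatticeK_G1LatticeK hpos, laplaceALatticeK_G1LatticeK hpos]

omit [NeZero N] [Fact (0 < (F.L : ℝ))] [Fact (0 < (F.P K).eta k)] in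
/-- ★ **`Δ_{1,a}𝔊 = 𝔓*` PAIRED WITH A TANGENT DIRECTION (83)**: for `Qx = 0`, `RD*x = 0`: `⟪x, Δ_{1,a}(𝔊_H y)⟫ = ⟪x, y⟫` — the `Q*`-term dies on `Qx = 0` (Hilbert adjoint),
the `DRD*`-term on `RD*x = 0` (`D* = D†` ✓`adjoint_covDerivL2K`, `R` symmetric ✓`RrOfRecord_isSymmetric`). [cite: Balaban1985Variational, (105)–(110) p.294] -/
theorem inner_laplaceA_frakG_of_tangent {x : BondL2K ℂ (F.P K).d (fun _ => (F.P K).sitesPerDir 0) (c0Rec F K k) (WRec N)}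
    (hQx : QOfRecord F N k U₀ x = 0)
    (hRx : RrOfRecord F N k U₀ (QflatOfRecord F N k) (covDivL2K ℂ (c0Rec F K k) (cRec F K k) (SRec F N U₀) x) = 0)
    (y : BondL2K ℂ (F.P K).d (fun _ => (F.P K).sitesPerDir 0) (c0Rec F K k) (WRec N)) :
    ⟪x, laplaceAOfRecordAt F N k U₀ Δ₁ (QOfRecord F N k U₀) (QflatOfRecord F N k) a (frakGLatticeK hpos hQ y)⟫_ℂ = ⟪x, y⟫_ℂ := by
  have hR : ∀ u v, ⟪RrOfRecord F N k U₀ (QflatOfRecord F N k) u, v⟫_ℂ = ⟪u, RrOfRecord F N k U₀ (QflatOfRecord F N k) v⟫_ℂ :=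
    RrOfRecord_isSymmetric F N k U₀ (QflatOfRecord F N k)
  rw [laplaceA_frakGLatticeK, inner_sub_right, inner_sub_right, LinearMap.adjoint_inner_right, hQx, inner_zero_left, sub_zero,
    ← LinearMap.adjoint_inner_left, adjoint_covDerivL2K (cRec F K k) (conj_cRec F K k) (RRec F N U₀) (SRec F N U₀) (inner_RRec_left U₀),
    ← hR, hRx, inner_zero_left, sub_zero]

omit [NeZero N] [Fact (0 < (F.L : ℝ))] [Fact (0 < (F.P K).eta k)] in
/-- ★ **(105)–(110): `⟪x, Δ_{1,a} y⟫ = ⟪x, Δ₁ y⟫` ON THE TANGENT SPACE (83)** — the gauge-fixing terms `DRD* + aQ*Q` of `Δ_{1,a}` are invisible against `x` with `Qx = 0`, `RD*x = 0`.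
[cite: Balaban1985Variational, (83) p.290, (105)–(110) p.294] -/
theorem inner_laplaceA_eq_inner_hess_of_tangent {x : BondL2K ℂ (F.P K).d (fun _ => (F.P K).sitesPerDir 0) (c0Rec F K k) (WRec N)}
    (hQx : QOfRecord F N k U₀ x = 0)
    (hRx : RrOfRecord F N k U₀ (QflatOfRecord F N k) (covDivL2K ℂ (c0Rec F K k) (cRec F K k) (SRec F N U₀) x) = 0)
    (y : BondL2K ℂ (F.P K).d (fun _ => (F.P K).sitesPerDir 0) (c0Rec F K k) (WRec N)) :
    ⟪x, laplaceAOfRecordAt F N k U₀ Δ₁ (QOfRecord F N k U₀) (QflatOfRecord F N k) a y⟫_ℂ = ⟪x, Δ₁ y⟫_ℂ := by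
  have hR : ∀ u v, ⟪RrOfRecord F N k U₀ (QflatOfRecord F N k) u, v⟫_ℂ = ⟪u, RrOfRecord F N k U₀ (QflatOfRecord F N k) v⟫_ℂ :=
    RrOfRecord_isSymmetric F N k U₀ (QflatOfRecord F N k)
  rw [show laplaceAOfRecordAt F N k U₀ Δ₁ (QOfRecord F N k U₀) (QflatOfRecord F N k) a y =
      Δ₁ y + covDerivL2K ℂ (c0Rec F K k) (cRec F K k) (RRec F N U₀) (RrOfRecord F N k U₀ (QflatOfRecord F N k)
        (covDivL2K ℂ (c0Rec F K k) (cRec F K k) (SRec F N U₀) y)) +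
      LinearMap.adjoint (QOfRecord F N k U₀) (((a : ℝ) : ℂ) • QOfRecord F N k U₀ y) from rfl,
    inner_add_right, inner_add_right, LinearMap.adjoint_inner_right, hQx, inner_zero_left, add_zero,
    ← LinearMap.adjoint_inner_left (covDerivL2K ℂ (c0Rec F K k) (cRec F K k) (RRec F N U₀)),
    adjoint_covDerivL2K (cRec F K k) (conj_cRec F K k) (RRec F N U₀) (SRec F N U₀) (inner_RRec_left U₀),
    ← hR, hRx, inner_zero_left, add_zero]

omit [NeZero N] in
include hι in
/-- **`ι(H₁B) = H₁,H B̂`**: the (115)-typed letter `H₁` of record read back on the `L²` bond space IS lit's Hilbert-level ✓`H1LatticeK` applied to the block field read the same way.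
[cite: Balaban1985Variational, (45) p.285, (103) p.293] -/
theorem iota_H1OfRecordAt (B : NegSize (F.L : ℝ) ((F.P K).eta k) levB 0 (Matrix (Fin N) (Fin N) ℂ)) :
    ι (H1OfRecordAt F N K k Ω U₀ levB Δ₁ (QOfRecord F N k U₀) (QflatOfRecord F N k) a hpos hQ B) =
      H1LatticeK hpos hQ ((funEquiv (phiRec N) (wBRec F K k)).symm (NegSup.equiv _ _ B)) := by
  rw [hι]
  apply (funEquiv (phiRec N) (fun _ : B9SectCLatticeCarrier.Bond (F.P K).d (fun _ => (F.P K).sitesPerDir 0) => c0Rec F K k)).injective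
  rw [LinearEquiv.apply_symm_apply]
  simp only [H1OfRecordAt, H1LatticeCLM, H1CLM, blockCLM115_apply, readFun_apply]

omit [NeZero N] [Fact (0 < (F.L : ℝ))] [Fact (0 < (F.P K).eta k)] in
/-- ★ **(100) ON `Qx = 0`: `⟪x, Δ_{1,a}(H₁b)⟫ = 0`** — `Δ_{1,a}H₁ = Δ_{1,a}G₁Q*(QG₁Q*)⁻¹ = Q*(QG₁Q*)⁻¹` and `⟪x, Q*z⟫ = ⟪Qx, z⟫ = 0`.
[cite: Balaban1985Variational, (100) p.293, (103) p.293] -/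
theorem inner_laplaceA_H1_of_tangent {x : BondL2K ℂ (F.P K).d (fun _ => (F.P K).sitesPerDir 0) (c0Rec F K k) (WRec N)}
    (hQx : QOfRecord F N k U₀ x = 0) (b : WL2 ℂ (wBRec F K k) (WRec N)) :
    ⟪x, laplaceAOfRecordAt F N k U₀ Δ₁ (QOfRecord F N k U₀) (QflatOfRecord F N k) a (H1LatticeK hpos hQ b)⟫_ℂ = 0 := by
  rw [H1LatticeK_eq, LinearMap.comp_apply, LinearMap.comp_apply]
  erw [laplaceALatticeK_G1LatticeK hpos]
  rw [LinearMap.adjoint_inner_right, hQx, inner_zero_left]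

omit [NeZero N] [Fact (0 < (F.L : ℝ))] [Fact (0 < (F.P K).eta k)] in
/-- ★ **(100) IN PRINT's FORM: `⟪δA′, Δ₁H₁B⟩ = 0` on the tangent space (83).** [cite: Balaban1985Variational, (100) p.293] -/
theorem inner_hess_H1_of_tangent {x : BondL2K ℂ (F.P K).d (fun _ => (F.P K).sitesPerDir 0) (c0Rec F K k) (WRec N)}
    (hQx : QOfRecord F N k U₀ x = 0)
    (hRx : RrOfRecord F N k U₀ (QflatOfRecord F N k) (covDivL2K ℂ (c0Rec F K k) (cRec F K k) (SRec F N U₀) x) = 0)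
    (b : WL2 ℂ (wBRec F K k) (WRec N)) : ⟪x, Δ₁ (H1LatticeK hpos hQ b)⟫_ℂ = 0 := by
  rw [← inner_laplaceA_eq_inner_hess_of_tangent F N k U₀ Δ₁ a hQx hRx, inner_laplaceA_H1_of_tangent F N k U₀ Δ₁ a hpos hQ hQx]

/-! ## §2  The (110) identity: the energy form of the Euler–Lagrange map equals print's (84)∕(99) pairing, on the tangent space -/

include hι in
/-- ★★★ **[15] (100)+(105)–(110) AT THE RECORD, HYPOTHESIS-FREE**: for a tangent direction `δ ∈ (102)` (`Qδ = 0`, `RD*δ = 0`), ANY `A`, `V`, ANY `W`, `J`,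
`⟪ιδ, Δ_{1,a}(U₀) ι(A − T(A))⟫ = ⟪ιδ, Ĵ⟫ + ⟪ιδ, Δ₁ ι(A + H₁B(V))⟫ + ⟪ιδ, (W(A + H₁B(V)))^⟫`, `T A = −𝔊J − 𝔊W(A + H₁B)` ((116)) — so the energy-form row of
✓`N07MinTokensOfCriticalRow` IS print's (84) `⟨δ, J⟩ + ⟨δ, Δ₁A′⟩ + ⟨δ, W(A′)⟩` read on (83). [cite: Balaban1985Variational, (84) p.290, (99)–(100) p.293, (105)–(111) p.294, (116) p.295] -/
theorem inner_laplaceA_sub_mapT_eq (W : Space115Lit F N K k Ω U₀ → NegSizeLit F N K k Ω 3) (J : NegSizeLit F N K k Ω 3)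
    {δ : Space115Lit F N K k Ω U₀} (hδ : δ ∈ constraint102OfRecord F N K k Ω U₀) (A : Space115Lit F N K k Ω U₀) (V : GaugeField (F.P K) k (SU N)) :
    ⟪ι δ, laplaceAOfRecordAt F N k U₀ Δ₁ (QOfRecord F N k U₀) (QflatOfRecord F N k) a
      (ι (A - mapT (frakGOfRecordAt F N K k Ω U₀ Δ₁ (QOfRecord F N k U₀) (QflatOfRecord F N k) a hpos hQ) 0 W J
        (H1OfRecordAt F N K k Ω U₀ levB Δ₁ (QOfRecord F N k U₀) (QflatOfRecord F N k) a hpos hQ (BOfRecord F N K k U₀ levB V)) A))⟫_ℂ =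
      ⟪ι δ, (funEquiv (phiRec N) (fun _ : B9SectCLatticeCarrier.Bond (F.P K).d (fun _ => (F.P K).sitesPerDir 0) => c0Rec F K k)).symm (NegSup.equiv _ _ J)⟫_ℂ +
      ⟪ι δ, Δ₁ (ι (A + H1OfRecordAt F N K k Ω U₀ levB Δ₁ (QOfRecord F N k U₀) (QflatOfRecord F N k) a hpos hQ (BOfRecord F N K k U₀ levB V)))⟫_ℂ +
      ⟪ι δ, (funEquiv (phiRec N) (fun _ : B9SectCLatticeCarrier.Bond (F.P K).d (fun _ => (F.P K).sitesPerDir 0) => c0Rec F K k)).symm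
        (NegSup.equiv _ _ (W (A + H1OfRecordAt F N K k Ω U₀ levB Δ₁ (QOfRecord F N k U₀) (QflatOfRecord F N k) a hpos hQ (BOfRecord F N K k U₀ levB V))))⟫_ℂ := by
  -- the tangent conditions on `ιδ`
  obtain ⟨hQδ, hRδ⟩ := (B11Eq111FrakG.mem_constraint102_iff _ _ _ _ _ δ).1 hδ
  have hQx : QOfRecord F N k U₀ (ι δ) = 0 := by rw [hι]; exact hQδ
  have hRx : RrOfRecord F N k U₀ (QflatOfRecord F N k) (covDivL2K ℂ (c0Rec F K k) (cRec F K k) (SRec F N U₀) (ι δ)) = 0 := by rw [hι]; exact hRδ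
  -- unfold (116) and read `𝔊` back on the Hilbert space
  set 𝔄 := H1OfRecordAt F N K k Ω U₀ levB Δ₁ (QOfRecord F N k U₀) (QflatOfRecord F N k) a hpos hQ (BOfRecord F N K k U₀ levB V) with h𝔄
  rw [mapT_noLinear]
  have hvec : A - (-(frakGOfRecordAt F N K k Ω U₀ Δ₁ (QOfRecord F N k U₀) (QflatOfRecord F N k) a hpos hQ) J -
      (frakGOfRecordAt F N K k Ω U₀ Δ₁ (QOfRecord F N k U₀) (QflatOfRecord F N k) a hpos hQ) (W (A + 𝔄))) =
      A + (frakGOfRecordAt F N K k Ω U₀ Δ₁ (QOfRecord F N k U₀) (QflatOfRecord F N k) a hpos hQ) J +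
        (frakGOfRecordAt F N K k Ω U₀ Δ₁ (QOfRecord F N k U₀) (QflatOfRecord F N k) a hpos hQ) (W (A + 𝔄)) := by abel
  have e1 : ι (A + (frakGOfRecordAt F N K k Ω U₀ Δ₁ (QOfRecord F N k U₀) (QflatOfRecord F N k) a hpos hQ) J +
        (frakGOfRecordAt F N K k Ω U₀ Δ₁ (QOfRecord F N k U₀) (QflatOfRecord F N k) a hpos hQ) (W (A + 𝔄))) =
      ι A + frakGLatticeK hpos hQ ((funEquiv (phiRec N) (fun _ : B9SectCLatticeCarrier.Bond (F.P K).d (fun _ => (F.P K).sitesPerDir 0) => c0Rec F K k)).symm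
          (NegSup.equiv _ _ J)) +
        frakGLatticeK hpos hQ ((funEquiv (phiRec N) (fun _ : B9SectCLatticeCarrier.Bond (F.P K).d (fun _ => (F.P K).sitesPerDir 0) => c0Rec F K k)).symm
          (NegSup.equiv _ _ (W (A + 𝔄)))) := by
    rw [map_add, map_add, iota_frakGOfRecordAt F N k Ω U₀ Δ₁ a hpos hQ ι hι, iota_frakGOfRecordAt F N k Ω U₀ Δ₁ a hpos hQ ι hι]
  rw [hvec, e1, map_add, map_add, inner_add_right, inner_add_right, inner_laplaceA_frakG_of_tangent F N k U₀ Δ₁ a hpos hQ hQx hRx,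
    inner_laplaceA_frakG_of_tangent F N k U₀ Δ₁ a hpos hQ hQx hRx, inner_laplaceA_eq_inner_hess_of_tangent F N k U₀ Δ₁ a hQx hRx]
  -- (100): the `𝔄 = H₁B` term is invisible on the tangent space
  have h100 : ⟪ι δ, Δ₁ (ι 𝔄)⟫_ℂ = 0 := by
    rw [h𝔄, iota_H1OfRecordAt F N k Ω U₀ levB Δ₁ a hpos hQ ι hι]
    exact inner_hess_H1_of_tangent F N k U₀ Δ₁ a hpos hQ hQx hRx _
  rw [map_add ι, map_add Δ₁, inner_add_right, h100, add_zero]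
  ring

end Slot

/-! ## §3  At the scheme's slot-(c) letters -/

section Bg128

variable (F : T4Family) (N : ℕ) [NeZero N] {K : ℕ} (k : ℕ) (Ω : ℕ → Set (Site (F.P K) 0)) (U₀ : GaugeField (F.P K) 0 (SU N))
  [Fact (0 < (F.L : ℝ))] [Fact (0 < (F.P K).eta k)] [Fact (0 < c0Rec F K k)] [Fact (∀ c, 0 < wBRec F K k c)]
  (levB : PBond (F.P K) k → ℕ)
  (Gp : SiteL2K ℂ (F.P K).d (fun _ => (F.P K).sitesPerDir 0) (c0Rec F K k) (WRec N) →ₗ[ℂ]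
    SiteL2K ℂ (F.P K).d (fun _ => (F.P K).sitesPerDir 0) (c0Rec F K k) (WRec N))
  (Δ2 : BondL2K ℂ (F.P K).d (fun _ => (F.P K).sitesPerDir 0) (c0Rec F K k) (WRec N) →ₗ[ℂ]
    BondL2K ℂ (F.P K).d (fun _ => (F.P K).sitesPerDir 0) (c0Rec F K k) (WRec N)) (a : ℝ)
  (hposπ : ∀ x, x ≠ 0 → 0 < RCLike.re ⟪x, laplaceAOfRecordAt F N k U₀ (hessOpOfRecord128 F N k U₀ Gp (QflatOfRecord F N k) Δ2)
    (QOfRecord F N k U₀) (QflatOfRecord F N k) a x⟫_ℂ)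
  (hQ : Function.Surjective (QOfRecord F N k U₀))
  (ι : Space115Lit F N K k Ω U₀ ≃ₗ[ℂ] BondL2K ℂ (F.P K).d (fun _ => (F.P K).sitesPerDir 0) (c0Rec F K k) (WRec N))
  (hι : ∀ y, ι y = (funEquiv (phiRec N) (fun _ : B9SectCLatticeCarrier.Bond (F.P K).d (fun _ => (F.P K).sitesPerDir 0) => c0Rec F K k)).symm
    (JetSup.equiv _ _ (nabla115 ((F.P K).eta k) (unitsOfRecord F N U₀)) y))

include hι in
/-- ★★★ **THE (110) IDENTITY AT THE SCHEME's SLOT-(c) LETTERS** (`𝔊(U₀) = frakGOfRecordAtBg128`, `𝔄 = frakAOfRecordAtBg128`, `Δ₁ = π†(Δ(U₀) + Δ⁽²⁾)π = hessOpOfRecord128`,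
`Δ_{1,a}` = the operator of the road's `hposπ`): for `δ ∈ (102)`, any `A`, `V`, `W`, `J`,
`⟪ιδ, Δ_{1,a} ι(A − mapT 𝔊 0 W J (𝔄 V) A)⟫ = ⟪ιδ, Ĵ⟫ + ⟪ιδ, Δ₁ ι(A + 𝔄 V)⟫ + ⟪ιδ, (W(A + 𝔄 V))^⟫`.
[cite: Balaban1985Variational, (84) p.290, (100) p.293, (105)–(111) p.294; Balaban1985BackgroundPropagators, (3.128) p.421] -/
theorem inner_laplaceA_sub_mapT_eq_bg128 (W : Space115Lit F N K k Ω U₀ → NegSizeLit F N K k Ω 3) (J : NegSizeLit F N K k Ω 3)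
    {δ : Space115Lit F N K k Ω U₀} (hδ : δ ∈ constraint102OfRecord F N K k Ω U₀) (A : Space115Lit F N K k Ω U₀) (V : GaugeField (F.P K) k (SU N)) :
    ⟪ι δ, laplaceAOfRecordAt F N k U₀ (hessOpOfRecord128 F N k U₀ Gp (QflatOfRecord F N k) Δ2) (QOfRecord F N k U₀) (QflatOfRecord F N k) a
      (ι (A - mapT (frakGOfRecordAtBg128 F N K k Ω U₀ Gp Δ2 a hposπ hQ) 0 W J (frakAOfRecordAtBg128 F N K k Ω U₀ levB Gp Δ2 a hposπ hQ V) A))⟫_ℂ =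
      ⟪ι δ, (funEquiv (phiRec N) (fun _ : B9SectCLatticeCarrier.Bond (F.P K).d (fun _ => (F.P K).sitesPerDir 0) => c0Rec F K k)).symm (NegSup.equiv _ _ J)⟫_ℂ +
      ⟪ι δ, hessOpOfRecord128 F N k U₀ Gp (QflatOfRecord F N k) Δ2 (ι (A + frakAOfRecordAtBg128 F N K k Ω U₀ levB Gp Δ2 a hposπ hQ V))⟫_ℂ +
      ⟪ι δ, (funEquiv (phiRec N) (fun _ : B9SectCLatticeCarrier.Bond (F.P K).d (fun _ => (F.P K).sitesPerDir 0) => c0Rec F K k)).symm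
        (NegSup.equiv _ _ (W (A + frakAOfRecordAtBg128 F N K k Ω U₀ levB Gp Δ2 a hposπ hQ V)))⟫_ℂ := by
  have h := inner_laplaceA_sub_mapT_eq F N k Ω U₀ levB (hessOpOfRecord128 F N k U₀ Gp (QflatOfRecord F N k) Δ2) a hposπ hQ ι hι W J hδ A V
  convert h <;> rfl

end Bg128

/-! ## §4  The knit tokens at the record modulo print's (84) verbatim -/

section Row84

variable (F : T4Family) (N : ℕ) [NeZero N] {K : ℕ} (k : ℕ) (Ω : ℕ → Set (Site (F.P K) 0)) (U₀ : GaugeField (F.P K) 0 (SU N))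
  [Fact (0 < (F.L : ℝ))] [Fact (0 < (F.P K).eta k)] (levB : PBond (F.P K) k → ℕ) [Fact (0 < c0Rec F K k)] [Fact (∀ c, 0 < wBRec F K k c)] (a : ℝ)
  (hposb : ∀ x, x ≠ 0 → 0 < RCLike.re ⟪x, laplaceAOfRecord F N k U₀ (QOfRecord F N k U₀) (QflatOfRecord F N k) a x⟫_ℂ)
  (hQ : Function.Surjective (QOfRecord F N k U₀))
  (Gp : SiteL2K ℂ (F.P K).d (fun _ => (F.P K).sitesPerDir 0) (c0Rec F K k) (WRec N) →ₗ[ℂ]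
    SiteL2K ℂ (F.P K).d (fun _ => (F.P K).sitesPerDir 0) (c0Rec F K k) (WRec N))
  (Δ2 : BondL2K ℂ (F.P K).d (fun _ => (F.P K).sitesPerDir 0) (c0Rec F K k) (WRec N) →ₗ[ℂ]
    BondL2K ℂ (F.P K).d (fun _ => (F.P K).sitesPerDir 0) (c0Rec F K k) (WRec N))
  (hposπ : ∀ x, x ≠ 0 → 0 < RCLike.re ⟪x, laplaceAOfRecordAt F N k U₀ (hessOpOfRecord128 F N k U₀ Gp (QflatOfRecord F N k) Δ2)
    (QOfRecord F N k U₀) (QflatOfRecord F N k) a x⟫_ℂ)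

/-- ★★★ **THE KNIT TOKENS (min) ∧ (c→s) AT THE SCHEME OF RECORD, LANDAU FAMILY, MODULO PRINT's (84) VERBATIM.**  As ✓`minTokens_ofRecord_landau`, with the ONE displayed row now
«the derivative of `A^η ∘ S.chartLin T V` at `A` in a tangent direction `δ ∈ (102) ∩ evHerm0` is `c·ℜ(⟨δ, J⟩ + ⟨δ, Δ₁(A + 𝔄V)⟩ + ⟨δ, W(A + 𝔄V)⟩)`» — [15] (84)∕(99) with `Δ₁ = π†(Δ(U₀) + Δ⁽²⁾)π`
((79)), the pairing read on the `L²` bond space along the canonical reading `ι` of jets and of currents — the Sect. D half (100)+(105)–(110) being §2's theorem.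
[cite: Balaban1985Variational, Thm 1 p.279, Prop. 5 p.294, Prop. 6 p.295, Prop. 7 p.299, (79)–(81) p.290, (84) p.290, (99)–(111) pp.293–294; Balaban1985BackgroundPropagators, Thm 3.12 p.421] -/
theorem minTokens_ofRecord_landau_of_row84 (c : ℝ) (hc : 0 < c)
    (ι : Space115Lit F N K k Ω U₀ ≃ₗ[ℂ] BondL2K ℂ (F.P K).d (fun _ => (F.P K).sitesPerDir 0) (c0Rec F K k) (WRec N))
    (hι : ∀ y, ι y = (funEquiv (phiRec N) (fun _ : B9SectCLatticeCarrier.Bond (F.P K).d (fun _ => (F.P K).sitesPerDir 0) => c0Rec F K k)).symm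
      (JetSup.equiv _ _ (nabla115 ((F.P K).eta k) (unitsOfRecord F N U₀)) y)) :
    ∃ M γ : ℝ, 0 ≤ M ∧ 0 < γ ∧
      ∀ (dom : Set (GaugeField (F.P K) k (SU N))) (εC B₀ C₄ a₃ j a𝔄 ε₄ ρ : ℝ)
        (T : GaugeField (F.P K) k (SU N) → Space115Lit F N K k Ω U₀ → Space115Lit F N K k Ω U₀)
        (S : BgSchemeOnLit F N K k Ω U₀) (_hS : S = bgSchemeOfRecord F N K k Ω U₀ dom levB Gp Δ2 a hposπ hposb hQ εC B₀ C₄ a₃ j a𝔄 ε₄),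
        ε₄ + a𝔄 ≤ ρ → 2 * (ρ + a𝔄 + a𝔄) ≤ a₃ → 4 * M * B₀ * C₄ * (ρ + a𝔄 + a𝔄) < γ →
        S.RegimeTok → FrakGSliceTok F N K k Ω U₀ Gp Δ2 a hposπ hQ → (∀ V ∈ dom, S.LieTokAt V) →
        (∀ V ∈ dom, ∀ A ∈ {A : Space115Lit F N K k Ω U₀ | A ∈ constraint102OfRecord F N K k Ω U₀ ∧ A + S.𝔄 V ∈ S.evHerm0 ∧ ‖A + S.𝔄 V‖ < ρ},
          ∀ δ ∈ {δ : Space115Lit F N K k Ω U₀ | δ ∈ constraint102OfRecord F N K k Ω U₀ ∧ δ ∈ S.evHerm0},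
          HasDerivAt (fun t : ℝ => wilsonAction4 (S.chartLin T V (A + t • δ)))
            (c * RCLike.re
              (⟪ι δ, (funEquiv (phiRec N) (fun _ : B9SectCLatticeCarrier.Bond (F.P K).d (fun _ => (F.P K).sitesPerDir 0) => c0Rec F K k)).symm
                  (NegSup.equiv _ _ (S.J V))⟫_ℂ +
                ⟪ι δ, hessOpOfRecord128 F N k U₀ Gp (QflatOfRecord F N k) Δ2 (ι (A + S.𝔄 V))⟫_ℂ +
                ⟪ι δ, (funEquiv (phiRec N) (fun _ : B9SectCLatticeCarrier.Bond (F.P K).d (fun _ => (F.P K).sitesPerDir 0) => c0Rec F K k)).symm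
                  (NegSup.equiv _ _ (S.W V (A + S.𝔄 V)))⟫_ℂ)) 0) →
        (∀ V ∈ dom, IsMinOn (wilsonAction4 ∘ S.chartLin T V)
            {A : Space115Lit F N K k Ω U₀ | A ∈ constraint102OfRecord F N K k Ω U₀ ∧ A + S.𝔄 V ∈ S.evHerm0 ∧ ‖A + S.𝔄 V‖ < ρ} (S.sol V)) ∧
        (∀ V ∈ dom, ∀ A ∈ {A : Space115Lit F N K k Ω U₀ | A ∈ constraint102OfRecord F N K k Ω U₀ ∧ A + S.𝔄 V ∈ S.evHerm0 ∧ ‖A + S.𝔄 V‖ < ρ},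
          IsMinOn (wilsonAction4 ∘ S.chartLin T V)
            {A : Space115Lit F N K k Ω U₀ | A ∈ constraint102OfRecord F N K k Ω U₀ ∧ A + S.𝔄 V ∈ S.evHerm0 ∧ ‖A + S.𝔄 V‖ < ρ} A →
          ‖A‖ ≤ S.ε₄ ∧ mapT (S.𝒢 V) 0 (S.W V) (S.J V) (S.𝔄 V) A = A) := by
  obtain ⟨M, γ, hM, hγ, hmain⟩ :=
    N07MinTokensOfCriticalRowAtRecord.minTokens_ofRecord_landau F N k Ω U₀ levB a hposb hQ Gp Δ2 hposπ c hc ι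
  refine ⟨M, γ, hM, hγ, fun dom εC B₀ C₄ a₃ j a𝔄 ε₄ ρ T S hS hfit hdom hnum hR h𝔊 hL row84 => ?_⟩
  refine hmain dom εC B₀ C₄ a₃ j a𝔄 ε₄ ρ T S hS hfit hdom hnum hR h𝔊 hL fun V hV A hA δ hδ => ?_
  subst hS
  have h := row84 V hV A hA δ hδ
  simp only [bgSchemeOfRecord_J, bgSchemeOfRecord_W, bgSchemeOfRecord_𝔄] at h
  rw [← inner_laplaceA_sub_mapT_eq_bg128 F N k Ω U₀ levB Gp Δ2 a hposπ hQ ι hι _ _ hδ.1 A V] at h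
  simp only [bgSchemeOfRecord_𝒢, bgSchemeOfRecord_J, bgSchemeOfRecord_W, bgSchemeOfRecord_𝔄]
  convert h using 3

end Row84

end Summit.QuantumFields.YangMills.Theorems.N07Row110AtRecord

end
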